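import Mathlib
import HarnessLib
import Summits.NavierStokesRegularity.NavierStokesRegularity.Theses.LocalLevelHeadDoor

/-!
# `LocalLevelHeadDoor.Assembly` (item stmt-NavierStokesRegularity-28098) — pure logic

`Assembly` is `LocalPointZoomSimilarityHead → LevelHeadSpread → LevelHeadProfileRigidity → Target`, i.e. the type of the route's
planner-authored deciding theorem `Theses.LocalLevelHeadDoor.closes` (kernel-checked in the route file); this item is that composition
BY NAME.

HONEST FRAMING: bookkeeping; the door's `Target` is NOT proved (it hangs on the two open cruxes 28095/28096); nothing here bears on
Navier–Stokes regularity.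
-/

noncomputable section

set_option linter.dupNamespace false

namespace Summit.NavierStokesRegularity.NavierStokesRegularity.Theorems

open Summit.NavierStokesRegularity.NavierStokesRegularity.Theses.LocalLevelHeadDoor

/-- **Item stmt-NavierStokesRegularity-28098** (`LocalLevelHeadDoor.Assembly`): the three items compose to the door's `Target` — by the
route's own kernel-checked deciding theorem `closes`. [folklore] -/
theorem localLevelHeadDoor_assembly_proof :
    Summit.NavierStokesRegularity.NavierStokesRegularity.Theses.LocalLevelHeadDoor.Assembly := by
  unfold Summit.NavierStokesRegularity.NavierStokesRegularity.Theses.LocalLevelHeadDoor.Assembly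
  exact fun h₁ h₂ h₃ => closes h₁ h₂ h₃

end Summit.NavierStokesRegularity.NavierStokesRegularity.Theorems

end
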